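import Summits.CriticalPhenomena.PercolationContinuityZ3.Theorems.PercNearOneGluingNoHeavyLowerTailSahiCoordinateChordPieces
import Summits.CriticalPhenomena.PercolationContinuityZ3.Theorems.PercNearOneGluingNoHeavyLowerTailSahiTwoLevelC3
import Summits.CriticalPhenomena.PercolationContinuityZ3.Theorems.PercNearOneGluingNoHeavyLowerTailSahiCoordinateTwoThirdsFiveCube
import Mathlib.Tactic.Linarith
import Mathlib.Tactic.Ring
import HarnessLib

/-!
# `NoHeavyLowerTail` (stmt-CriticalPhenomena-4575) — BRIDGE between the one-coordinate Bernstein pieces (master-family line P2) and the two-level forms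
# (lane prim-bnk-2 / prim-ineq-gen-4): `b₂ + E_3(U⁰) + E_3(U¹) = T⁺(U¹,U⁰)`, `b₁ + E_3(U⁰) + E_3(U¹) = T(U¹,U⁰)`; consequences for (T3∀), MC2 = `SahiTwoLevelPlus`, and
# "TOP cannot be sharpened to `T⁺ ≥ E_3(G)`"

Support file (cell `prim-l12`, lane prim-bnk-2 gen 14; `--supports stmt-CriticalPhenomena-4575`).  No definition, no sorry, standard axioms.

Two vocabularies for the same fibre cubic `Φ(s) = E_3(μ_{p[e↦s]}; 1_A,1_B,1_C) = B₀(1−s)³ + 3B₁s(1−s)² + 3B₂s²(1−s) + B₃s³` live in the tree: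
* P2 (`…SahiCoordinateBernstein/ChordPieces/TwoThirds`): the pieces `b₁ = coordPiece₁ = 3B₁ − 2B₀ − B₃`, `b₂ = coordPiece₂ = 3B₂ − B₀ − 2B₃` (closed form
  `coordPiece₂_eq`), the refuted (T3∀) `TwoThirds` = `b₂ + B₀ ≥ 0` and master-conj's MC1/MC2/BGC categories;
* this lane (`…SahiTwoLevelC3`, prim-ineq-gen-4 g5): the two-level form `T(G,H) = twoLevelForm` of the nested sections `G = U¹ ⊇ H = U⁰` (`= 3B₁ − B₀`,
  `twoLevelForm_secAt_eq`) and `T⁺ = T − ∏δ` (`= 3B₂ − B₃`), with the conjectures `SahiTwoLevelMinus` (`T ≥ 0`, "C₃-M⁻" = MC1) and `SahiTwoLevelPlus`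
  (`T⁺ ≥ 0`, "C₃-M⁺" = MC2), both census-clean and both implying Kahn's `C_3`.
THIS FILE identifies them formally (all at the sections of a triple along `e`, `P = ex (bernoulliWeight p) ∘ ind = (prodBernoulli p).real`):
* `coordPiece₂_add_eq_twoLevelPlus` : `b₂(e) + E_3(U⁰) + E_3(U¹) = T(U¹,U⁰) − ∏_i (m(U_i¹) − m(U_i⁰))`  (= `T⁺`; so `3B₂ = T⁺ + B₃`);
* `coordPiece₁_add_eq_twoLevelForm` : `b₁(e) + E_3(U⁰) + E_3(U¹) = T(U¹,U⁰)`;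
* `twoThirds_quantity_eq` : the (T3∀) quantity `b₂(e) + E_3(U⁰)` IS `T⁺(U¹,U⁰) − E_3(U¹)` — (T3∀) said "TOP dominates `E_3` of the top sections";
* `coordPiece₂_add_nonneg_of_sahiTwoLevelPlus` : `SahiTwoLevelPlus` gives `0 ≤ b₂(e) + E_3(U⁰) + E_3(U¹)` at every coordinate (MC2 at sections);
* `exists_twoLevelPlus_lt_sahiE_top` : from the five-cube witness of `…TwoThirdsFiveCube` (`3B₂ − 2B₃ = −1/432`), there are nested increasing section
  pairs with `T⁺(G,H) < E_3(G)` — the TOP law `SahiTwoLevelPlus` (`T⁺ ≥ 0`) cannot be sharpened to `T⁺ ≥ E_3(G)` (census of this seat: on `{0,1}^5` the exact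
  infimum of `T⁺/E_3(G)` is `17/18` at `q ≡ 1/3`, `≥ 1` at `q ≡ 1/2`; `135/144` at the five-coin witness of `…TwoThirdsFiveCube` and `→ 7/8` along that
  triple as its two end coins become rare; the owner's `Fin 7` instance gives `11/12`; the coefficientwise floor from (C¼) would be `3/4`).
HONEST FRAMING: identities and one consequence of a landed refutation; `SahiTwoLevelPlus/Minus`, Kahn's Conjecture 5 / Sahi's `C_3` remain OPEN.  Axioms standard. [this work]
-/

noncomputable section

open scoped Classical

namespace Summit.CriticalPhenomena.PercolationContinuityZ3.Theorems

namespace SahiTwoLevel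

open Finset Function
open Literature.Combinatorics.Sahi2008
open Literature.Probability.LatticeModels (prodBernoulli)
open Literature.Probability.Percolation.DecisionTree (ind ind_of_mem ind_of_not_mem ind_nonneg)
open SahiCoordinateBernstein (coordPiece₁ coordPiece₂)

variable {ι : Type} [Fintype ι] (p : ι → unitInterval) (e : ι) (A B C : Set (Set ι))

/-- **`b₂ + B₀ + B₃ = T⁺`**: the second Bernstein piece plus `E_3` of both sections is the lane's TOP two-level form `T(U¹,U⁰) − ∏δ` of the nested sections.
[this work] -/
theorem coordPiece₂_add_eq_twoLevelPlus :
    coordPiece₂ p e ![A, B, C]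
        + sahiE (bernoulliWeight p) 3 ![ind (secAt e false A), ind (secAt e false B), ind (secAt e false C)]
        + sahiE (bernoulliWeight p) 3 ![ind (secAt e true A), ind (secAt e true B), ind (secAt e true C)] =
      twoLevelForm (fun X => ex (bernoulliWeight p) (ind X)) ![secAt e true A, secAt e true B, secAt e true C]
          ![secAt e false A, secAt e false B, secAt e false C]
        - ∏ i : Fin 3, (ex (bernoulliWeight p) (ind ((![secAt e true A, secAt e true B, secAt e true C] : Fin 3 → Set (Set ι)) i))
            - ex (bernoulliWeight p) (ind ((![secAt e false A, secAt e false B, secAt e false C] : Fin 3 → Set (Set ι)) i))) := by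
  rw [SahiCoordinateChord.coordPiece₂_eq, sahiE_three_apply, sahiE_three_apply, twoLevelForm, Fin.prod_univ_three]
  simp only [Matrix.cons_val_zero, Matrix.cons_val_one, Matrix.cons_val, ind_mul_ind, ← secAt_inter]
  ring

/-- **`b₁ + B₀ + B₃ = T`**: the first Bernstein piece plus `E_3` of both sections is the two-level form `T(U¹,U⁰) = 3B₁ − B₀` itself. [this work] -/
theorem coordPiece₁_add_eq_twoLevelForm :
    coordPiece₁ p e ![A, B, C]
        + sahiE (bernoulliWeight p) 3 ![ind (secAt e false A), ind (secAt e false B), ind (secAt e false C)]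
        + sahiE (bernoulliWeight p) 3 ![ind (secAt e true A), ind (secAt e true B), ind (secAt e true C)] =
      twoLevelForm (fun X => ex (bernoulliWeight p) (ind X)) ![secAt e true A, secAt e true B, secAt e true C]
          ![secAt e false A, secAt e false B, secAt e false C] := by
  have h2 := coordPiece₂_add_eq_twoLevelPlus p e A B C
  have hs := SahiCoordinateChord.coordPiece₁_sub_coordPiece₂_ex p e A B C
  rw [Fin.prod_univ_three] at h2
  simp only [Matrix.cons_val_zero, Matrix.cons_val_one, Matrix.cons_val] at h2
  linarith

/-- **The (T3∀) quantity is `T⁺ − E_3(top sections)`**: `b₂(e) + E_3(U⁰) = [T(U¹,U⁰) − ∏δ] − E_3(U¹)`. [this work] -/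
theorem twoThirds_quantity_eq :
    coordPiece₂ p e ![A, B, C]
        + sahiE (bernoulliWeight p) 3 ![ind (secAt e false A), ind (secAt e false B), ind (secAt e false C)] =
      (twoLevelForm (fun X => ex (bernoulliWeight p) (ind X)) ![secAt e true A, secAt e true B, secAt e true C]
          ![secAt e false A, secAt e false B, secAt e false C]
        - ∏ i : Fin 3, (ex (bernoulliWeight p) (ind ((![secAt e true A, secAt e true B, secAt e true C] : Fin 3 → Set (Set ι)) i))
            - ex (bernoulliWeight p) (ind ((![secAt e false A, secAt e false B, secAt e false C] : Fin 3 → Set (Set ι)) i))))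
        - sahiE (bernoulliWeight p) 3 ![ind (secAt e true A), ind (secAt e true B), ind (secAt e true C)] := by
  have h2 := coordPiece₂_add_eq_twoLevelPlus p e A B C
  linarith

/-- **MC2 at sections from the TOP law**: `SahiTwoLevelPlus` gives `0 ≤ b₂(e) + E_3(U⁰) + E_3(U¹)` (i.e. `3B₂(e) ≥ B₃(e)`) at every coordinate of every
increasing triple. [this work] -/
theorem coordPiece₂_add_nonneg_of_sahiTwoLevelPlus (hP : SahiTwoLevelPlus) (hA : IsUpperSet A) (hB : IsUpperSet B) (hC : IsUpperSet C) :
    0 ≤ coordPiece₂ p e ![A, B, C]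
        + sahiE (bernoulliWeight p) 3 ![ind (secAt e false A), ind (secAt e false B), ind (secAt e false C)]
        + sahiE (bernoulliWeight p) 3 ![ind (secAt e true A), ind (secAt e true B), ind (secAt e true C)] := by
  rw [coordPiece₂_add_eq_twoLevelPlus]
  have hG : ∀ i, IsUpperSet ((![secAt e true A, secAt e true B, secAt e true C] : Fin 3 → Set (Set ι)) i) := by
    intro i; fin_cases i
    · exact isUpperSet_secAt e true hA
    · exact isUpperSet_secAt e true hB
    · exact isUpperSet_secAt e true hC
  have hH : ∀ i, IsUpperSet ((![secAt e false A, secAt e false B, secAt e false C] : Fin 3 → Set (Set ι)) i) := by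
    intro i; fin_cases i
    · exact isUpperSet_secAt e false hA
    · exact isUpperSet_secAt e false hB
    · exact isUpperSet_secAt e false hC
  have hHG : ∀ i, (![secAt e false A, secAt e false B, secAt e false C] : Fin 3 → Set (Set ι)) i ⊆
      (![secAt e true A, secAt e true B, secAt e true C] : Fin 3 → Set (Set ι)) i := by
    intro i; fin_cases i
    · exact secAt_false_subset_true e hA
    · exact secAt_false_subset_true e hB
    · exact secAt_false_subset_true e hC
  have h := hP ι p _ _ hG hH hHG
  simp only [← ex_bernoulliWeight_ind] at h
  exact h

/-- **TOP cannot be sharpened to `T⁺ ≥ E_3(G)`**: there are a finite cube, a product weight and NESTED increasing triples `H_i ⊆ G_i` (the sections of the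
five-cube witness of `…SahiCoordinateTwoThirdsFiveCube`) with `T(G,H) − ∏_i (m(G_i) − m(H_i)) < E_3(G)`. [this work] -/
theorem exists_twoLevelPlus_lt_sahiE_top :
    ∃ (κ : Type) (_ : Fintype κ) (q : κ → unitInterval) (G H : Fin 3 → Set (Set κ)),
      (∀ i, IsUpperSet (G i)) ∧ (∀ i, IsUpperSet (H i)) ∧ (∀ i, H i ⊆ G i) ∧
      twoLevelForm (fun X => (prodBernoulli q).real X) G H - ∏ i, ((prodBernoulli q).real (G i) - (prodBernoulli q).real (H i))
        < sahiE (bernoulliWeight q) 3 (fun i => ind (G i)) := by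
  obtain ⟨p, A, B, C, e, hA, hB, hC, -, hlt⟩ := SahiCoordinateTwoThirds.twoThirds_fails_on_fin_five
  refine ⟨Fin 5, inferInstance, p, ![secAt e true A, secAt e true B, secAt e true C], ![secAt e false A, secAt e false B, secAt e false C],
    ?_, ?_, ?_, ?_⟩
  · intro i; fin_cases i
    · exact isUpperSet_secAt e true hA
    · exact isUpperSet_secAt e true hB
    · exact isUpperSet_secAt e true hC
  · intro i; fin_cases i
    · exact isUpperSet_secAt e false hA
    · exact isUpperSet_secAt e false hB
    · exact isUpperSet_secAt e false hC
  · intro i; fin_cases i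
    · exact secAt_false_subset_true e hA
    · exact secAt_false_subset_true e hB
    · exact secAt_false_subset_true e hC
  · rw [twoThirds_quantity_eq] at hlt
    have hf : (fun i => ind ((![secAt e true A, secAt e true B, secAt e true C] : Fin 3 → Set (Set (Fin 5))) i)) =
        ![ind (secAt e true A), ind (secAt e true B), ind (secAt e true C)] := by
      funext i; fin_cases i <;> rfl
    rw [hf]
    simp only [← ex_bernoulliWeight_ind]
    linarith

end SahiTwoLevel

end Summit.CriticalPhenomena.PercolationContinuityZ3.Theorems
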